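import Summits.CriticalPhenomena.Ising3D.Control2DTermwise
import Literature.MathematicalPhysics.QuantumFieldTheory.ConformalBootstrap3D.PointFunctionalTail
import Mathlib.Analysis.SpecialFunctions.Pow.Real
import Mathlib.Tactic.Linarith
import Mathlib.Tactic.Ring
import Mathlib.Tactic.Positivity
import HarnessLib

/-!
# The 2D control: the TAIL obligation (T) reduced to one apex-bracket inequality — proved
(cell `pub-ising3x`, seat controls-1; companion of `Control2DTermwise.lean`)

HONEST FRAMING: lottery ticket; floor = tightest certified 3D Ising CFT bounds; no exact-solution
claim without a proof.

`Control2DTermwise.PairPositiveAbove φ s Δ⋆` asks `φ[F_-[x^a y^b + x^b y^a]] ≥ 0` for ALL real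
`a, b ≥ 0` with `a + b ≥ Δ⋆`, `a - b ∈ ℤ` — infinitely many inequalities. Verifier A's obligation (T)
(`verify_points2d/1.1`, "apex bracket") discharges them from ONE number: with an apex node
`(z_a, z̄_a)` (weight `w_a > 0`) that DOMINATES every other evaluation datum `(x, y)` — direct nodes
`(z_k, z̄_k)` and reflected nodes `(1-z̄_k, 1-z_k)` — in the sense `xy ≤ q² z_a z̄_a`, `x ≤ q z_a`
with a ratio `0 < q ≤ 1` (`q = (s/s_a)·max(1, ρ/ρ_a)` in the verifier's variables `s = √(xy)`,
`ρ = √(x/y)`), one has the growth comparison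
`x^a y^b + x^b y^a ≤ q^{a+b} (z_a^a z̄_a^b + z_a^b z̄_a^a)` (`pairPow_le_of_dominated`; from the tree's
`pairTerm_le`, the `d = 3` Legendre version, at `b = 0`), hence termwise
`φ[F_-[pairPow a b]] ≥ pairPow a b (apex) · (w_a v_a^s - Σ_{k≠a} |w_k| v_k^s qd_k^{a+b} - Σ_k |w_k| u_k^s qr_k^{a+b})`
(`pointFunctional_crossF_pairPow_lower`) and, since `q ≤ 1`, the bracket only improves with `a + b`:
`B(Δ⋆) := w_a v_a^s - Σ_{k≠a} |w_k| v_k^s qd_k^{Δ⋆} - Σ_k |w_k| u_k^s qr_k^{Δ⋆} ≥ 0 ⇒ PairPositiveAbove φ s Δ⋆`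
(`pairPositiveAbove_of_apex`, PROVED). With even `Δ⋆ = 2T` and `Q = q²` rational, `q^{Δ⋆} = Q^T` is
rational, so `B(Δ⋆) ≥ 0` is decidable up to the eighth roots `v^s, u^s` (`s = 1/8`) — see
`Control2DCertificateRB0Tail.lean`. `PairPositiveAbove.of_split` splits the above-`E₀` obligation
into the window `[E₀, Δ⋆)` ((M), interval arithmetic) and the tail `≥ Δ⋆` ((T), this file).

Sources: the `d = 3` original `Literature/…/ConformalBootstrap3D/PointFunctionalTail.lean`
(pub-ising3d; Hogervorst–Rychkov 2013 §3 `z`-series variables); R. Rattazzi, V. S. Rychkov, E. Tonni,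
A. Vichi, JHEP 12 (2008) 031, §5.5 (asymptotic control of the functional beyond the trial set).
Mathlib: `Real.rpow_le_rpow`, `Real.mul_rpow`, `Real.rpow_add`, `Real.rpow_le_rpow_of_exponent_ge`.
-/

namespace Summit.CriticalPhenomena.Ising3D.Control2D

open Set Finset
open Literature.MathematicalPhysics.QuantumFieldTheory.ConformalBootstrap3D

/-! ### Elementary properties of the pair monomial -/

/-- `pairPow a b x y ≥ 0` for `x, y ≥ 0`. [folklore] -/
theorem pairPow_nonneg (a b : ℝ) {x y : ℝ} (hx : 0 ≤ x) (hy : 0 ≤ y) : 0 ≤ pairPow a b x y := by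
  unfold pairPow
  positivity

/-- Symmetry in the point: `pairPow a b x y = pairPow a b y x`. [folklore] -/
theorem pairPow_symm (a b x y : ℝ) : pairPow a b x y = pairPow a b y x := by
  unfold pairPow; ring

/-- Symmetry in the exponents: `pairPow a b = pairPow b a`. [folklore] -/
theorem pairPow_comm (a b x y : ℝ) : pairPow a b x y = pairPow b a x y := by
  unfold pairPow; ring

/-- Factorisation when the exponents differ by a natural number: for `x, y > 0`,
`x^{b+m} y^b + x^b y^{b+m} = (xy)^b (x^m + y^m)`. [folklore] -/
theorem pairPow_eq_of_nat {b x y : ℝ} (hx : 0 < x) (hy : 0 < y) (m : ℕ) :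
    pairPow (b + m) b x y = (x * y) ^ b * (x ^ m + y ^ m) := by
  unfold pairPow
  rw [Real.rpow_add hx, Real.rpow_add hy, Real.rpow_natCast, Real.rpow_natCast,
    Real.mul_rpow hx.le hy.le]
  ring

/-- **Growth comparison for pair monomials** (the `d = 2` "apex domination", Chebyshev version of
the tree's Legendre lemma): for `0 < y ≤ x`, `0 < y' ≤ x'`, `0 < q`, `xy ≤ q² x'y'`, `x ≤ q x'`, and
exponents `a, b ≥ 0` with `a - b ∈ ℤ`:
`x^a y^b + x^b y^a ≤ q^{a+b} (x'^a y'^b + x'^b y'^a)`. (Reduce to `a = b + m`, `m ∈ ℕ`; then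
`(xy)^b ≤ q^{2b}(x'y')^b` and `x^m + y^m ≤ q^m(x'^m + y'^m)` = `pairTerm_le` at `b = 0`.) [folklore] -/
theorem pairPow_le_of_dominated {x y x' y' q a b : ℝ} (hy : 0 < y) (hyx : y ≤ x) (hy' : 0 < y')
    (hyx' : y' ≤ x') (hq : 0 < q) (hs : x * y ≤ q ^ 2 * (x' * y')) (hxx : x ≤ q * x')
    (ha : 0 ≤ a) (hb : 0 ≤ b) (hab : ∃ j : ℤ, a - b = j) :
    pairPow a b x y ≤ q ^ (a + b) * pairPow a b x' y' := by
  have hx : 0 < x := hy.trans_le hyx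
  have hx' : 0 < x' := hy'.trans_le hyx'
  -- reduce to `b ≤ a` using the symmetry in the exponents
  wlog hba : b ≤ a generalizing a b
  · obtain ⟨j, hj⟩ := hab
    have h := this hb ha ⟨-j, by push_cast; linarith⟩ (le_of_not_ge hba)
    rw [pairPow_comm a b x y, pairPow_comm a b x' y', add_comm a b]
    exact h
  -- `a = b + m` with `m : ℕ`
  obtain ⟨j, hj⟩ := hab
  have hj0 : (0 : ℤ) ≤ j := by
    have : (0 : ℝ) ≤ (j : ℝ) := by rw [← hj]; linarith
    exact_mod_cast this
  obtain ⟨m, hm⟩ := Int.eq_ofNat_of_zero_le hj0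
  have ham : a = b + (m : ℝ) := by
    have : (j : ℝ) = (m : ℝ) := by rw [hm]; rfl
    linarith
  subst ham
  rw [pairPow_eq_of_nat hx hy m, pairPow_eq_of_nat hx' hy' m]
  -- the two factors
  have h1 : (x * y) ^ b ≤ q ^ (2 * b) * (x' * y') ^ b := by
    calc (x * y) ^ b ≤ (q ^ 2 * (x' * y')) ^ b :=
          Real.rpow_le_rpow (mul_nonneg hx.le hy.le) hs hb
      _ = (q ^ 2) ^ b * (x' * y') ^ b := Real.mul_rpow (by positivity) (by positivity)
      _ = q ^ (2 * b) * (x' * y') ^ b := by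
          rw [show ((q ^ 2 : ℝ)) = q ^ ((2 : ℕ) : ℝ) by rw [Real.rpow_natCast], ← Real.rpow_mul hq.le]
          norm_num
  have h2 : x ^ m + y ^ m ≤ q ^ m * (x' ^ m + y' ^ m) := by
    have := pairTerm_le hy hyx hy' hyx' hq.le hs hxx 0 m
    simpa using this
  have hqpow : q ^ (b + (m : ℝ) + b) = q ^ (2 * b) * q ^ m := by
    rw [show b + (m : ℝ) + b = 2 * b + (m : ℝ) by ring, Real.rpow_add hq, Real.rpow_natCast]
  rw [hqpow]
  have hA : 0 ≤ q ^ (2 * b) * (x' * y') ^ b := by positivity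
  have hB : 0 ≤ x ^ m + y ^ m := by positivity
  calc (x * y) ^ b * (x ^ m + y ^ m)
      ≤ (q ^ (2 * b) * (x' * y') ^ b) * (x ^ m + y ^ m) := mul_le_mul_of_nonneg_right h1 hB
    _ ≤ (q ^ (2 * b) * (x' * y') ^ b) * (q ^ m * (x' ^ m + y' ^ m)) :=
        mul_le_mul_of_nonneg_left h2 hA
    _ = q ^ (2 * b) * q ^ m * ((x' * y') ^ b * (x' ^ m + y' ^ m)) := by ring

/-! ### The termwise lower bound and the tail rule -/

/-- **Termwise lower bound at a dominated configuration** (`d = 2` twin of the tree's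
`pointFunctional_crossF_zMono_lower`). Nodes `(z_k, z̄_k)` in the open square with `z̄_k ≤ z_k`; an
apex node `a`; ratios `qd_k, qr_k > 0` with `z_k z̄_k ≤ qd_k² z_a z̄_a`, `z_k ≤ qd_k z_a` (direct
nodes) and `(1-z_k)(1-z̄_k) ≤ qr_k² z_a z̄_a`, `1-z̄_k ≤ qr_k z_a` (reflected nodes). Then for
`a', b ≥ 0` with `a' - b ∈ ℤ` and `E = a' + b`,
`φ[F^{s}_-[pairPow a' b]] ≥ pairPow a' b (z_a,z̄_a) · (w_a v_a^s - Σ_{k≠a} |w_k| v_k^s qd_k^E - Σ_k |w_k| u_k^s qr_k^E)`.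
[folklore] -/
theorem pointFunctional_crossF_pairPow_lower {N : ℕ} (w z zb : Fin N → ℝ)
    (hz : ∀ k, z k ∈ Ioo (0 : ℝ) 1) (hzb : ∀ k, zb k ∈ Ioo (0 : ℝ) 1) (hord : ∀ k, zb k ≤ z k)
    (a : Fin N) (qd qr : Fin N → ℝ) (hqd : ∀ k, 0 < qd k) (hqr : ∀ k, 0 < qr k)
    (hdomd : ∀ k, z k * zb k ≤ qd k ^ 2 * (z a * zb a) ∧ z k ≤ qd k * z a)
    (hdomr : ∀ k, (1 - z k) * (1 - zb k) ≤ qr k ^ 2 * (z a * zb a) ∧ 1 - zb k ≤ qr k * z a)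
    {a' b : ℝ} (ha' : 0 ≤ a') (hb : 0 ≤ b) (hab : ∃ j : ℤ, a' - b = j) (s : ℝ) :
    pairPow a' b (z a) (zb a) *
        (w a * ((1 - z a) * (1 - zb a)) ^ s
          - ∑ k ∈ univ.erase a, |w k| * ((1 - z k) * (1 - zb k)) ^ s * qd k ^ (a' + b)
          - ∑ k, |w k| * (z k * zb k) ^ s * qr k ^ (a' + b)) ≤
      pointFunctional w z zb (crossF s (-1) (pairPow a' b)) := by
  set E := a' + b with hE
  have hv0 : ∀ k, 0 ≤ (1 - z k) * (1 - zb k) := fun k =>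
    mul_nonneg (by linarith [(hz k).2]) (by linarith [(hzb k).2])
  have hu0 : ∀ k, 0 ≤ z k * zb k := fun k => mul_nonneg (hz k).1.le (hzb k).1.le
  have hM0 : 0 ≤ pairPow a' b (z a) (zb a) := pairPow_nonneg a' b (hz a).1.le (hzb a).1.le
  -- direct nodes are dominated by the apex
  have hMk : ∀ k, pairPow a' b (z k) (zb k) ≤ qd k ^ E * pairPow a' b (z a) (zb a) := fun k =>
    pairPow_le_of_dominated (hzb k).1 (hord k) (hzb a).1 (hord a) (hqd k) (hdomd k).1 (hdomd k).2
      ha' hb hab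
  -- reflected nodes are dominated by the apex
  have hRk : ∀ k, pairPow a' b (1 - z k) (1 - zb k) ≤ qr k ^ E * pairPow a' b (z a) (zb a) := by
    intro k
    rw [pairPow_symm a' b (1 - z k) (1 - zb k)]
    have h1 : (1 - zb k) * (1 - z k) ≤ qr k ^ 2 * (z a * zb a) := by
      rw [mul_comm]; exact (hdomr k).1
    exact pairPow_le_of_dominated (by linarith [(hz k).2]) (by linarith [hord k]) (hzb a).1 (hord a)
      (hqr k) h1 (hdomr k).2 ha' hb hab
  -- termwise lower bounds
  have hterm1 : ∀ k,
      -(|w k| * ((1 - z k) * (1 - zb k)) ^ s * qd k ^ E * pairPow a' b (z a) (zb a)) ≤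
        w k * ((1 - z k) * (1 - zb k)) ^ s * pairPow a' b (z k) (zb k) := by
    intro k
    have hvs : 0 ≤ ((1 - z k) * (1 - zb k)) ^ s := Real.rpow_nonneg (hv0 k) s
    have h1 : -|w k| * (((1 - z k) * (1 - zb k)) ^ s * pairPow a' b (z k) (zb k)) ≤
        w k * (((1 - z k) * (1 - zb k)) ^ s * pairPow a' b (z k) (zb k)) :=
      mul_le_mul_of_nonneg_right (neg_abs_le _)
        (mul_nonneg hvs (pairPow_nonneg a' b (hz k).1.le (hzb k).1.le))
    have h2 : -|w k| * ((1 - z k) * (1 - zb k)) ^ s * (qd k ^ E * pairPow a' b (z a) (zb a)) ≤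
        -|w k| * ((1 - z k) * (1 - zb k)) ^ s * pairPow a' b (z k) (zb k) :=
      mul_le_mul_of_nonpos_left (hMk k)
        (mul_nonpos_of_nonpos_of_nonneg (neg_nonpos.2 (abs_nonneg _)) hvs)
    calc -(|w k| * ((1 - z k) * (1 - zb k)) ^ s * qd k ^ E * pairPow a' b (z a) (zb a))
        = -|w k| * ((1 - z k) * (1 - zb k)) ^ s * (qd k ^ E * pairPow a' b (z a) (zb a)) := by
          ring
      _ ≤ -|w k| * ((1 - z k) * (1 - zb k)) ^ s * pairPow a' b (z k) (zb k) := h2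
      _ = -|w k| * (((1 - z k) * (1 - zb k)) ^ s * pairPow a' b (z k) (zb k)) := by ring
      _ ≤ w k * (((1 - z k) * (1 - zb k)) ^ s * pairPow a' b (z k) (zb k)) := h1
      _ = w k * ((1 - z k) * (1 - zb k)) ^ s * pairPow a' b (z k) (zb k) := by ring
  have hterm2 : ∀ k, -(|w k| * (z k * zb k) ^ s * qr k ^ E * pairPow a' b (z a) (zb a)) ≤
      -(w k * (z k * zb k) ^ s * pairPow a' b (1 - z k) (1 - zb k)) := by
    intro k
    have hus : 0 ≤ (z k * zb k) ^ s := Real.rpow_nonneg (hu0 k) s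
    apply neg_le_neg
    have h1 : w k * ((z k * zb k) ^ s * pairPow a' b (1 - z k) (1 - zb k)) ≤
        |w k| * ((z k * zb k) ^ s * pairPow a' b (1 - z k) (1 - zb k)) :=
      mul_le_mul_of_nonneg_right (le_abs_self _)
        (mul_nonneg hus (pairPow_nonneg a' b (by linarith [(hz k).2]) (by linarith [(hzb k).2])))
    have h2 : |w k| * (z k * zb k) ^ s * pairPow a' b (1 - z k) (1 - zb k) ≤
        |w k| * (z k * zb k) ^ s * (qr k ^ E * pairPow a' b (z a) (zb a)) :=
      mul_le_mul_of_nonneg_left (hRk k) (mul_nonneg (abs_nonneg _) hus)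
    calc w k * (z k * zb k) ^ s * pairPow a' b (1 - z k) (1 - zb k)
        = w k * ((z k * zb k) ^ s * pairPow a' b (1 - z k) (1 - zb k)) := by ring
      _ ≤ |w k| * ((z k * zb k) ^ s * pairPow a' b (1 - z k) (1 - zb k)) := h1
      _ = |w k| * (z k * zb k) ^ s * pairPow a' b (1 - z k) (1 - zb k) := by ring
      _ ≤ |w k| * (z k * zb k) ^ s * (qr k ^ E * pairPow a' b (z a) (zb a)) := h2
      _ = |w k| * (z k * zb k) ^ s * qr k ^ E * pairPow a' b (z a) (zb a) := by ring
  -- assemble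
  calc pairPow a' b (z a) (zb a) *
        (w a * ((1 - z a) * (1 - zb a)) ^ s
          - ∑ k ∈ univ.erase a, |w k| * ((1 - z k) * (1 - zb k)) ^ s * qd k ^ E
          - ∑ k, |w k| * (z k * zb k) ^ s * qr k ^ E)
      = w a * ((1 - z a) * (1 - zb a)) ^ s * pairPow a' b (z a) (zb a)
          + ∑ k ∈ univ.erase a,
              -(|w k| * ((1 - z k) * (1 - zb k)) ^ s * qd k ^ E * pairPow a' b (z a) (zb a))
          + ∑ k, -(|w k| * (z k * zb k) ^ s * qr k ^ E * pairPow a' b (z a) (zb a)) := by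
        rw [sum_neg_distrib, sum_neg_distrib, ← sum_mul, ← sum_mul]
        ring
    _ ≤ w a * ((1 - z a) * (1 - zb a)) ^ s * pairPow a' b (z a) (zb a)
          + ∑ k ∈ univ.erase a, w k * ((1 - z k) * (1 - zb k)) ^ s * pairPow a' b (z k) (zb k)
          + ∑ k, -(w k * (z k * zb k) ^ s * pairPow a' b (1 - z k) (1 - zb k)) :=
        add_le_add (add_le_add le_rfl (sum_le_sum fun k _ => hterm1 k))
          (sum_le_sum fun k _ => hterm2 k)
    _ = ∑ k, w k * ((1 - z k) * (1 - zb k)) ^ s * pairPow a' b (z k) (zb k)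
          + ∑ k, -(w k * (z k * zb k) ^ s * pairPow a' b (1 - z k) (1 - zb k)) := by
        rw [add_sum_erase univ
          (fun k => w k * ((1 - z k) * (1 - zb k)) ^ s * pairPow a' b (z k) (zb k)) (mem_univ a)]
    _ = pointFunctional w z zb (crossF s (-1) (pairPow a' b)) := by
        rw [pointFunctional_apply, ← sum_add_distrib]
        refine sum_congr rfl fun k _ => ?_
        simp only [crossF]
        ring

/-- **The tail rule (T).** In the dominated configuration with all ratios `0 < q ≤ 1` and `Δ⋆ ≥ 0`,
the single inequality
`Σ_{k≠a} |w_k| v_k^s qd_k^{Δ⋆} + Σ_k |w_k| u_k^s qr_k^{Δ⋆} ≤ w_a v_a^s`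
gives `PairPositiveAbove φ s Δ⋆` — every pair monomial with `a + b ≥ Δ⋆` (all `j = a - b ∈ ℤ`):
`φ[F_-[pairPow a b]] ≥ pairPow a b (apex) · B(a+b) ≥ pairPow a b (apex) · B(Δ⋆) ≥ 0` because
`q^{a+b} ≤ q^{Δ⋆}` for `q ≤ 1`. PROVED. [folklore] -/
theorem pairPositiveAbove_of_apex {N : ℕ} (w z zb : Fin N → ℝ)
    (hz : ∀ k, z k ∈ Ioo (0 : ℝ) 1) (hzb : ∀ k, zb k ∈ Ioo (0 : ℝ) 1) (hord : ∀ k, zb k ≤ z k)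
    (a : Fin N) (qd qr : Fin N → ℝ) (hqd : ∀ k, 0 < qd k ∧ qd k ≤ 1)
    (hqr : ∀ k, 0 < qr k ∧ qr k ≤ 1)
    (hdomd : ∀ k, z k * zb k ≤ qd k ^ 2 * (z a * zb a) ∧ z k ≤ qd k * z a)
    (hdomr : ∀ k, (1 - z k) * (1 - zb k) ≤ qr k ^ 2 * (z a * zb a) ∧ 1 - zb k ≤ qr k * z a)
    {Δstar s : ℝ}
    (hB : ∑ k ∈ univ.erase a, |w k| * ((1 - z k) * (1 - zb k)) ^ s * qd k ^ Δstar
          + ∑ k, |w k| * (z k * zb k) ^ s * qr k ^ Δstar ≤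
        w a * ((1 - z a) * (1 - zb a)) ^ s) :
    PairPositiveAbove (pointFunctional w z zb) s Δstar := by
  intro a' b ha' hb hE hab
  have hlow := pointFunctional_crossF_pairPow_lower w z zb hz hzb hord a qd qr (fun k => (hqd k).1)
    (fun k => (hqr k).1) hdomd hdomr ha' hb hab s
  refine le_trans (mul_nonneg (pairPow_nonneg a' b (hz a).1.le (hzb a).1.le) ?_) hlow
  have hv0 : ∀ k, 0 ≤ (1 - z k) * (1 - zb k) := fun k =>
    mul_nonneg (by linarith [(hz k).2]) (by linarith [(hzb k).2])
  have hu0 : ∀ k, 0 ≤ z k * zb k := fun k => mul_nonneg (hz k).1.le (hzb k).1.le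
  have hS1 : ∑ k ∈ univ.erase a, |w k| * ((1 - z k) * (1 - zb k)) ^ s * qd k ^ (a' + b) ≤
      ∑ k ∈ univ.erase a, |w k| * ((1 - z k) * (1 - zb k)) ^ s * qd k ^ Δstar :=
    sum_le_sum fun k _ => mul_le_mul_of_nonneg_left
      (Real.rpow_le_rpow_of_exponent_ge (hqd k).1 (hqd k).2 hE)
      (mul_nonneg (abs_nonneg _) (Real.rpow_nonneg (hv0 k) s))
  have hS2 : ∑ k, |w k| * (z k * zb k) ^ s * qr k ^ (a' + b) ≤
      ∑ k, |w k| * (z k * zb k) ^ s * qr k ^ Δstar :=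
    sum_le_sum fun k _ => mul_le_mul_of_nonneg_left
      (Real.rpow_le_rpow_of_exponent_ge (hqr k).1 (hqr k).2 hE)
      (mul_nonneg (abs_nonneg _) (Real.rpow_nonneg (hu0 k) s))
  linarith

/-- **Splitting the above-threshold obligation at `Δ⋆`**: the window `[E₀, Δ⋆)` (verifier (M)) and the
tail `≥ Δ⋆` (verifier (T), `pairPositiveAbove_of_apex`) together give `PairPositiveAbove φ s E₀`.
Elementary. [folklore] -/
theorem PairPositiveAbove.of_split {φ : (ℝ → ℝ → ℝ) →ₗ[ℝ] ℝ} {s E₀ Δstar : ℝ}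
    (hM : ∀ a b : ℝ, 0 ≤ a → 0 ≤ b → E₀ ≤ a + b → a + b < Δstar → (∃ j : ℤ, a - b = j) →
      0 ≤ φ (crossF s (-1) (pairPow a b)))
    (hT : PairPositiveAbove φ s Δstar) : PairPositiveAbove φ s E₀ := by
  intro a b ha hb hE hab
  rcases lt_or_ge (a + b) Δstar with hlt | hge
  · exact hM a b ha hb hE hlt hab
  · exact hT a b ha hb hge hab

end Summit.CriticalPhenomena.Ising3D.Control2D
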